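import Summits.ABC.IUTFork.Cor312FormsBridge
import Summits.ABC.IUTFork.Cor312ProvenanceQ
import HarnessLib

/-!
# [IUTchIII] Cor. 3.12 — the provenance link vs the verbatim ↔ Dupuy–Hilado identification: the `q`-side is a
# THEOREM at the printed (normalized) scale, and the `[F:ℚ]`-rescaled identification is unsatisfiable
# (c312 crew, wave 2, board row W2-F′; a NORMALISATION CHECK, no side taken)

Record-only file of the abc-iut cell (seat abc-iut-c312-8, gen 2). The cell holds two glue conditions on the SAME real
number, c312-7's verbatim `−|log(q)| = P.negLogQ` of a Cor. 3.12 setting `P`: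

* the provenance link (`Cor312Provenance.lean`, this seat): `IsSettingOf D P` carries `negLogQ_eq : P.negLogQ = −absLogq D`
  with `absLogq D = (1/2l)·log(q)`, `log(q) = deg(𝔮^F_{ADiv})` the NORMALIZED degree ([IUTchIV] Def. 1.9 (i), `(1/[F:ℚ])·Σ`;
  [IUTchIV] Thm. 1.10, kurims p. 23: "the quantity “`|log(q)| ∈ ℝ_{>0}`” defined in [IUTchIII], Corollary 3.12, is equal
  to `(1/2l)·log(q) ∈ ℝ`" — and "the various `log(q_{(−)})`'s are independent of the choice of `F□`", which only the
  normalized degree is); this is also the scale of [IUTchIII] Rmk. 3.1.1 (ii)'s normalized weights (abc-iut-L6-t4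
  `packetWeight_normalized`: "multiplication by `p_{v_ℚ}` affects log-volumes by … `log(p_{v_ℚ})`") and of campaign S's
  `Thm110Numerics` (abc-iut-S3);
* the verbatim ↔ Dupuy–Hilado identification (`Cor312FormsBridge.lean`, abc-iut-c312-6): `VerbatimDHAgreement
  (toCor312Setting H) DH.toSetting`, unfolded by `agreement_iff` to `P.negLogQ = [F:ℚ]·DH.negAbsLogqDH` (and the `Θ`-side
  twin), the factor `[F:ℚ]` coming from abc-iut-c312-3's `DHData.toSetting`, which rescales Dupuy–Hilado's NORMALIZED
  `ln ν̄_𝕃` (`lnνL_regionq : … = −deĝ̲(P_q)`, `FinDivisor.ndeg`) to the skeleton's un-normalized degrees (`LDHCor312Skel`: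
  "`ln ν̄ := [F:ℚ]·ln ν̄_𝕃` … rescaled to the skeleton's un-normalised degrees").

THIS FILE (all PROVED; hypotheses = the two provenance links `IsSettingOf D P` (verbatim side) and `IsPilotDataOf D DH.X`
(DH side: same `l`, `S = 𝕍(F)^bad`, `ord_v(q_v)`; `Cor312ProvenanceDH.lean`)):
* `negAbsLogqDH_eq_neg_absLogq`: `DH.negAbsLogqDH = −absLogq D` — Dupuy–Hilado's `ln ν̄_𝕃(O_𝕃(−P_q)) = −deĝ̲(P_q)` IS minus
  `(1/2l)·log(q)` of the datum;
* **`negLogQ_eq_negAbsLogqDH`**: `P.negLogQ = DH.negAbsLogqDH` — the `q`-half of the verbatim ↔ DH identification is a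
  THEOREM at the printed scale (no `[F:ℚ]`);
* **`finrank_eq_one_of_scaled_q_agreement`** / **`not_scaled_q_agreement`** / **`not_verbatimDHAgreement`**: the
  `[F:ℚ]`-rescaled `q`-identification forces `[F:ℚ] = 1`, impossible for initial Θ-data ([IUTchI] Def. 3.1 (a): `√−1 ∈ F`);
  hence `VerbatimDHAgreement (toCor312Setting H) DH.toSetting` is FALSE for every verbatim setting and DH datum that are both
  attached to the same initial Θ-data — the identification hypothesis of `Cor312Vol.statement_iff_cor312DH` cannot be
  instantiated through the provenance links as currently scaled (repair: compare `P` with the UN-rescaled DH numbers, as below,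
  or divide c312-3's container volumes by `[F:ℚ]`; the inequality-level bridges `cor312_iff_cor312DH` are scale-invariant and
  unaffected);
* **`statement_iff_cor312DH_of_links`**: the CORRECTLY SCALED bridge — under the two links and the ONE remaining identification
  `P.negLogTheta = ↑DH.negLogThetaDH` (verbatim hull log-volume = DH's normalized `ln ν̄_𝕃(hull(U_Θ))`),
  `P.Statement ↔ DH.Cor312DH`; one-directional forms with `≤` in place of `=` (`cor312DH_of_statement_of_links`,
  `statement_of_cor312DH_of_links`).
Nothing here says which typed form is "right" about Cor. 3.12 itself; it records that two of OUR glue hypotheses differ by the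
factor `[F:ℚ]` and supplies the consistent composite. [claim: Mochizuki2012, status: disputed] for every quotation.
-/

noncomputable section

namespace Summit.ABC.IUTFork.Cor312Prov

open Literature.IUT.HodgeTheaters Literature.IUT.LogVolume NumberField IsDedekindDomain

universe v w

variable {F : Type} {K : Type v} {Fbar : Type w} [Field F] [NumberField F] [Field K] [NumberField K]
  [Algebra F K] [Field Fbar] [Algebra F Fbar] [Algebra K Fbar] {E : WeierstrassCurve F} [E.IsElliptic]
  {l : ℕ} {Pb : BadPlacePredicates K}
  {D : InitialThetaData F K Fbar E l Pb} {T : Thm311.ThetaIndex} {S : Thm311.Situation T} {P : Cor312.Setting S}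
  {DH : DHData F}

/-! ## 1. The `q`-side numbers of the three parties coincide at the printed (normalized) scale -/

/-- **Dupuy–Hilado's `−|log(q)|` IS minus `(1/2l)·log(q)` of the datum**: for a DH datum attached to the initial Θ-data `D`
(`IsPilotDataOf D DH.X`), `DH.negAbsLogqDH = ln ν̄_𝕃(O_𝕃(−P_q)) = −deĝ̲_F(P_q)` (c312-3's `lnνL_regionq`, DH Thm. 3.10.1) and
`deĝ̲_F(P_q) = absLogq D` (`absLogq_eq_ndeg_qPilot`). PROVED. [cite: DupuyHilado2025, §1 (1.1), Thm. 3.10.1] -/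
theorem negAbsLogqDH_eq_neg_absLogq (hX : IsPilotDataOf D DH.X) : DH.negAbsLogqDH = -absLogq D := by
  rw [absLogq_eq_ndeg_qPilot hX]
  exact DH.lnνL_regionq

/-- **The `q`-half of the verbatim ↔ Dupuy–Hilado identification is a THEOREM at the printed scale**: if the verbatim
setting `P` and the DH datum `DH` are both attached to the initial Θ-data `D` (`IsSettingOf D P`, `IsPilotDataOf D DH.X`),
then c312-7's `−|log(q)|` equals c312-3's `ln ν̄_𝕃(O_𝕃(−P_q))` — both are `−(1/2l)·log(q)` ([IUTchIV] p. 23), NO factor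
`[F:ℚ]`. PROVED. [claim: Mochizuki2012, status: disputed] -/
theorem negLogQ_eq_negAbsLogqDH (hS : IsSettingOf D P) (hX : IsPilotDataOf D DH.X) :
    P.negLogQ = DH.negAbsLogqDH := by
  rw [hS.negLogQ_eq, negAbsLogqDH_eq_neg_absLogq hX]

/-! ## 2. The `[F:ℚ]`-rescaled identification is unsatisfiable through the links -/

/-- If, through the two provenance links, the verbatim `−|log(q)|` ALSO satisfied the `[F:ℚ]`-RESCALED identification
`P.negLogQ = [F:ℚ]·DH.negAbsLogqDH` (the `q`-field of c312-6's `VerbatimDHAgreement (toCor312Setting H) DH.toSetting`,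
`Cor312FormsBridge.agreement_iff`), then `[F:ℚ] = 1`: both identities give `absLogq D = [F:ℚ]·absLogq D` with
`absLogq D > 0` (`absLogq_pos`). PROVED. [claim: Mochizuki2012, status: disputed] -/
theorem finrank_eq_one_of_scaled_q_agreement (hS : IsSettingOf D P) (hX : IsPilotDataOf D DH.X)
    (hq : P.negLogQ = (Module.finrank ℚ F : ℝ) * DH.negAbsLogqDH) : Module.finrank ℚ F = 1 := by
  have hpos := absLogq_pos D
  rw [hS.negLogQ_eq, negAbsLogqDH_eq_neg_absLogq hX] at hq
  -- `−a = n·(−a)` with `a > 0` forces `n = 1`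
  have h1 : ((Module.finrank ℚ F : ℝ) - 1) * absLogq D = 0 := by linarith
  have h2 : (Module.finrank ℚ F : ℝ) - 1 = 0 := by
    rcases mul_eq_zero.mp h1 with h | h
    · exact h
    · exact absurd h hpos.ne'
  have h3 : (Module.finrank ℚ F : ℝ) = 1 := by linarith
  exact_mod_cast h3

/-- A number field containing `√−1` ([IUTchI] Def. 3.1 (a): "`F` is a number field such that `√−1 ∈ F`") has
`[F:ℚ] ≠ 1`: otherwise `F = ℚ` and `−1` would be a rational square. PROVED. [claim: Mochizuki2012, status: disputed] -/
theorem finrank_ne_one_of_sqrt_neg_one (D : InitialThetaData F K Fbar E l Pb) : Module.finrank ℚ F ≠ 1 := by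
  intro h1
  obtain ⟨i, hi⟩ := D.sqrt_neg_one_mem
  -- `[F:ℚ] = 1`: every element of `F` is rational
  have hbot : (⊥ : Subalgebra ℚ F) = ⊤ := Subalgebra.bot_eq_top_iff_finrank_eq_one.mpr h1
  have hi' : i ∈ (⊥ : Subalgebra ℚ F) := by rw [hbot]; exact Algebra.mem_top
  obtain ⟨q, hq⟩ := Algebra.mem_bot.mp hi'
  have hq2 : (algebraMap ℚ F) (q ^ 2) = (algebraMap ℚ F) (-1) := by rw [map_pow, hq, hi, map_neg, map_one]
  have hq3 : q ^ 2 = -1 := (algebraMap ℚ F).injective hq2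
  nlinarith [sq_nonneg q]

/-- **The `[F:ℚ]`-rescaled `q`-identification cannot hold** for a verbatim setting and a DH datum attached to the same
initial Θ-data: `P.negLogQ ≠ [F:ℚ]·DH.negAbsLogqDH` (the correct identity is `negLogQ_eq_negAbsLogqDH`, without the
factor). PROVED. [claim: Mochizuki2012, status: disputed] -/
theorem not_scaled_q_agreement (hS : IsSettingOf D P) (hX : IsPilotDataOf D DH.X) :
    P.negLogQ ≠ (Module.finrank ℚ F : ℝ) * DH.negAbsLogqDH := fun hq =>
  finrank_ne_one_of_sqrt_neg_one D (finrank_eq_one_of_scaled_q_agreement hS hX hq)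

/-- **Consequently c312-6's identification hypothesis is unsatisfiable through the provenance links as currently scaled**:
for NO `BridgeHyps H` does `VerbatimDHAgreement (toCor312Setting H) DH.toSetting` hold when `P` and `DH` are attached to
the same initial Θ-data — its `q`-field is the rescaled identity refuted above (`Cor312FormsBridge.agreement_iff`). The
inequality-level bridges (`cor312_iff_cor312DH`, `statement_iff_cor312`) are scale-invariant and NOT affected; what must
change is only the scale at which the verbatim numbers are compared with c312-3's container (see §3). PROVED.
[claim: Mochizuki2012, status: disputed] -/
theorem not_verbatimDHAgreement (H : Cor312Vol.BridgeHyps P) (hS : IsSettingOf D P) (hX : IsPilotDataOf D DH.X) :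
    ¬ Cor312Vol.VerbatimDHAgreement (Cor312Vol.toCor312Setting H) DH.toSetting := fun hA =>
  not_scaled_q_agreement hS hX ((Cor312Vol.agreement_iff H DH).mp hA).2

/-! ## 3. The correctly scaled verbatim ↔ Dupuy–Hilado bridge through the links -/

/-- **[IUTchIII] Cor. 3.12 as printed ↔ Dupuy–Hilado (1.1), through the provenance links, at the printed scale.** For a
verbatim setting `P` and a DH datum `DH` attached to the same initial Θ-data `D`, the `q`-sides agree by
`negLogQ_eq_negAbsLogqDH`; under the ONE remaining identification — the verbatim hull log-volume `−|log(Θ)|` is Dupuy–Hilado's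
NORMALIZED `ln ν̄_𝕃(hull(U_Θ))` (`hΘ`, no `[F:ℚ]`) — the printed statement "`−|log(Θ)| ∈ ℝ` and `−|log(q)| ≤ −|log(Θ)|`"
(c312-7) is Dupuy–Hilado's "`−deĝ̲(P_q) ≤ ln ν̄_𝕃(hull(U_Θ))`" (c312-3 `Cor312DH`, via `cor312DH_iff_logvol`). PROVED; neither
side asserted. [cite: DupuyHilado2025, §1 (1.1)] -/
theorem statement_iff_cor312DH_of_links (hS : IsSettingOf D P) (hX : IsPilotDataOf D DH.X)
    (hΘ : P.negLogTheta = ((DH.negLogThetaDH : ℝ) : WithTop ℝ)) : P.Statement ↔ DH.Cor312DH := by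
  rw [DH.cor312DH_iff_logvol, Cor312.Setting.Statement, hΘ, negLogQ_eq_negAbsLogqDH hS hX]
  constructor
  · rintro ⟨-, hle⟩
    exact WithTop.coe_le_coe.mp hle
  · intro hle
    exact ⟨WithTop.coe_ne_top, WithTop.coe_le_coe.mpr hle⟩

/-- One-directional form (cf. c312-6's `cor312DH_of_statement_of_le`, here correctly scaled and with the `q`-side
DISCHARGED): if the verbatim `−|log(Θ)|` is at most DH's `ln ν̄_𝕃(hull(U_Θ))` (e.g. DH's coarser (Ind2) makes their hull region
larger — abc-iut-L6-t24 R7-C3-N3), the printed statement for `P` implies Dupuy–Hilado's (1.1) for `DH`. PROVED.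
[cite: DupuyHilado2025, §1 (1.1)] -/
theorem cor312DH_of_statement_of_links (hS : IsSettingOf D P) (hX : IsPilotDataOf D DH.X)
    (hΘ : P.negLogTheta ≤ ((DH.negLogThetaDH : ℝ) : WithTop ℝ)) (h : P.Statement) : DH.Cor312DH := by
  rw [DH.cor312DH_iff_logvol, ← negLogQ_eq_negAbsLogqDH hS hX]
  obtain ⟨-, hle⟩ := h
  exact WithTop.coe_le_coe.mp (hle.trans hΘ)

/-- The converse one-directional form: if DH's `ln ν̄_𝕃(hull(U_Θ))` is at most the verbatim `−|log(Θ)|` (`hΘ`, a bound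
from BELOW, so the finiteness "`−|log(Θ)| ∈ ℝ`" of the printed statement is a separate hypothesis `hfin`), Dupuy–Hilado's
(1.1) for `DH` implies the printed statement for `P`. PROVED. [cite: DupuyHilado2025, §1 (1.1)] -/
theorem statement_of_cor312DH_of_links (hS : IsSettingOf D P) (hX : IsPilotDataOf D DH.X)
    (hΘ : ((DH.negLogThetaDH : ℝ) : WithTop ℝ) ≤ P.negLogTheta) (hfin : P.negLogTheta ≠ ⊤) (h : DH.Cor312DH) :
    P.Statement := by
  rw [DH.cor312DH_iff_logvol, ← negLogQ_eq_negAbsLogqDH hS hX] at h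
  exact ⟨hfin, (WithTop.coe_le_coe.mpr h).trans hΘ⟩

end Summit.ABC.IUTFork.Cor312Prov

end
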